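import Literature.NumberTheory.GaloisRepresentations.FrameLiftPoints
import Literature.NumberTheory.GaloisRepresentations.LocalGaloisGroupFrobeniusProofs
import HarnessLib

/-!
# The universal unramified framed deformation ring as a `PointwiseLiftingRing`

Let `K` be a non-archimedean local field, `L/ℚ_p` finite in `ℚ̄_p` with integers `𝒪` and residue
field `k` (discrete), and `ρ̄ : Γ_K → GL_n(k)` a continuous UNRAMIFIED representation.  We PROVE
that `R⁰ = 𝒪⟦X_{ij}⟧` (`frameRing L n`) with the universal unramified lift `frameLift`
(`UnramifiedFrameLift`) is a `PointwiseLiftingRing` (in the sense of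
`CrystallineDeformationRing`) for the condition "`ρ` is unramified (and `Q`)", `Q` any true
proposition: `unramifiedLiftingRing`.  All twelve structure fields are theorems of the preceding
files (`UnramifiedFrameRing`, `UnramifiedFrameLift`, `FrameRingPoints`, `FrameRingEvaluation`,
`FrameLiftPoints`); this is Kisin's `R^□` ([Kisin2007] (2.3.3), (3.3.3), (3.3.8)) in the unramified
case, where it is the formally smooth `𝒪`-algebra `𝒪⟦X_{ij}⟧` (Mazur).

Also: transport of `PointwiseLiftingRing` along equivalent conditions (`PointwiseLiftingRing.congr`)
and the residual representation of an unramified lift is unramified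
(`isLocallyUnramified_of_reducesTo`).

No named facts, no `sorry`.

## References

* M. Kisin, *Potentially semi-stable deformation rings*, JAMS 21 (2008), (2.3.3), (3.3.3), (3.3.8).
  [Kisin2007]
* B. Mazur, *An introduction to the deformation theory of Galois representations* (1997), §10.
-/

noncomputable section

open IsLocalRing Field ValuativeRel
open scoped MatrixGroups

namespace Literature.NumberTheory.GaloisRepresentations

open IsNonarchimedeanLocalField

/-! ### Transport along equivalent conditions -/

/-- A `PointwiseLiftingRing` for `𝒞` is one for any condition equivalent to `𝒞`. [folklore] -/
def PointwiseLiftingRing.congr {Γ : Type} [Group Γ] [TopologicalSpace Γ] {p : ℕ} [Fact p.Prime]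
    {O : Type} [CommRing O] [Algebra O (PadicAlgCl p)] {k : Type} [Field k] [Algebra O k] [TopologicalSpace k]
    {n : ℕ} {ρbar : Γ →ₜ* GL (Fin n) k} {C C' : FramedRep Γ (PadicAlgCl p) n → Prop}
    (h : ∀ ρ, C ρ ↔ C' ρ) (𝓡 : PointwiseLiftingRing Γ p O k ρbar C) : PointwiseLiftingRing Γ p O k ρbar C' := by
  have hCC' : C = C' := funext fun ρ => propext (h ρ)
  exact hCC' ▸ 𝓡

section Unramified

variable {K : Type} [Field K] [ValuativeRel K] [TopologicalSpace K] [IsNonarchimedeanLocalField K]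
  {p : ℕ} [Fact p.Prime] (L : IntermediateField ℚ_[p] (PadicAlgCl p)) [FiniteDimensional ℚ_[p] L] {n : ℕ}
  [Algebra (intermediateFieldIntegers p L) (PadicAlgCl p)]
  [IsScalarTower (intermediateFieldIntegers p L) L (PadicAlgCl p)]
  [TopologicalSpace (ResidueField (intermediateFieldIntegers p L))]

omit [ValuativeRel K] [TopologicalSpace K] [IsNonarchimedeanLocalField K] [FiniteDimensional ℚ_[p] L]
  [TopologicalSpace (ResidueField (intermediateFieldIntegers p L))] in
/-- **The residual representation of an unramified lift is unramified**: if `ρ` reduces to `ρ̄`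
through `𝒪_L` and `ρ(σ) = 1`, then `ρ̄(σ) = 1`. [folklore] -/
theorem residual_eq_one_of_reducesTo {ρ : absoluteGaloisGroup K →* GL (Fin n) (PadicAlgCl p)}
    {ρbar : absoluteGaloisGroup K →* GL (Fin n) (ResidueField (intermediateFieldIntegers p L))}
    (hred : ReducesTo (intermediateFieldIntegers p L) ρ ρbar) {σ : absoluteGaloisGroup K} (hσ : ρ σ = 1) :
    ρbar σ = 1 := by
  refine Units.ext (Matrix.ext fun i j => ?_)
  obtain ⟨a, ha⟩ := residue_surjective (R := intermediateFieldIntegers p L)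
    (((ρbar σ : GL (Fin n) (ResidueField (intermediateFieldIntegers p L))) :
      Matrix (Fin n) (Fin n) (ResidueField (intermediateFieldIntegers p L))) i j)
  have h1 := hred σ i j a (by rw [IsLocalRing.ResidueField.algebraMap_eq, ha])
  rw [hσ, Units.val_one] at h1
  -- `‖δ_{ij} - a‖ < 1` in `ℚ̄_p`, so `residue a = δ_{ij}`
  set c : intermediateFieldIntegers p L := if i = j then 1 else 0 with hc
  have hc1 : (1 : Matrix (Fin n) (Fin n) (PadicAlgCl p)) i j = algebraMap (intermediateFieldIntegers p L) (PadicAlgCl p) c := by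
    rw [Matrix.one_apply, hc]
    split_ifs <;> simp
  rw [hc1, ← map_sub] at h1
  have hmem : c - a ∈ maximalIdeal (intermediateFieldIntegers p L) := by
    rw [intermediateFieldIntegers.mem_maximalIdeal_iff, intermediateFieldIntegers.norm_coe,
      ← algebraMap_integers_padicAlgCl_apply]
    exact h1
  have hres : residue _ a = residue _ c := by
    rw [eq_comm, ← sub_eq_zero, ← map_sub, IsLocalRing.residue_eq_zero_iff]
    exact hmem
  rw [← ha, hres, hc, Units.val_one, Matrix.one_apply]
  split_ifs <;> simp

omit [FiniteDimensional ℚ_[p] L] in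
/-- An unramified lift has unramified reduction. [folklore] -/
theorem isLocallyUnramified_of_reducesTo {ρ : FramedRep (absoluteGaloisGroup K) (PadicAlgCl p) n}
    {ρbar : FramedRep (absoluteGaloisGroup K) (ResidueField (intermediateFieldIntegers p L)) n}
    (hred : ReducesTo (intermediateFieldIntegers p L) ρ.toMonoidHom ρbar.toMonoidHom) (hρ : ρ.IsLocallyUnramified) :
    ρbar.IsLocallyUnramified :=
  fun σ hσ => residual_eq_one_of_reducesTo L hred (hρ σ hσ)

variable [DiscreteTopology (ResidueField (intermediateFieldIntegers p L))]
  (ρbar : FramedRep (absoluteGaloisGroup K) (ResidueField (intermediateFieldIntegers p L)) n)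

omit [ValuativeRel K] [TopologicalSpace K] [IsNonarchimedeanLocalField K] [FiniteDimensional ℚ_[p] L]
  [Algebra (intermediateFieldIntegers p L) (PadicAlgCl p)] [IsScalarTower (intermediateFieldIntegers p L) L (PadicAlgCl p)] in
/-- The kernel of a continuous representation into `GL_n(k)` (discrete) is open. [folklore] -/
theorem isOpen_ker_residual : IsOpen (ρbar.toMonoidHom.ker : Set (absoluteGaloisGroup K)) := by
  have h : (ρbar.toMonoidHom.ker : Set (absoluteGaloisGroup K)) = ρbar ⁻¹' {1} := by
    ext σ
    simp only [SetLike.mem_coe, MonoidHom.mem_ker, Set.mem_preimage, Set.mem_singleton_iff]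
    rfl
  rw [h]
  exact (isOpen_discrete _).preimage ρbar.continuous

omit [FiniteDimensional ℚ_[p] L] [Algebra (intermediateFieldIntegers p L) (PadicAlgCl p)]
  [IsScalarTower (intermediateFieldIntegers p L) L (PadicAlgCl p)] [DiscreteTopology (ResidueField (intermediateFieldIntegers p L))] in
/-- `I_K ≤ ker ρ̄` for unramified `ρ̄`. [folklore] -/
theorem absInertia_le_ker_of_isLocallyUnramified (hρ : ρbar.IsLocallyUnramified) :
    absInertia K ≤ ρbar.toMonoidHom.ker :=
  fun σ hσ => (MonoidHom.mem_ker).2 (hρ σ hσ)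

/-- A chosen arithmetic Frobenius of `K`. [folklore] -/
def someFrob (K : Type) [Field K] [ValuativeRel K] [TopologicalSpace K] [IsNonarchimedeanLocalField K] :
    absoluteGaloisGroup K :=
  (exists_isAbsArithFrob_holds (F := K)).choose

/-- `someFrob K` is an arithmetic Frobenius. [folklore] -/
theorem isAbsArithFrob_someFrob (K : Type) [Field K] [ValuativeRel K] [TopologicalSpace K] [IsNonarchimedeanLocalField K] :
    IsAbsArithFrob (someFrob K) :=
  (exists_isAbsArithFrob_holds (F := K)).choose_spec

omit [Algebra (intermediateFieldIntegers p L) (PadicAlgCl p)] [IsScalarTower (intermediateFieldIntegers p L) L (PadicAlgCl p)]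
  [TopologicalSpace (ResidueField (intermediateFieldIntegers p L))]
  [DiscreteTopology (ResidueField (intermediateFieldIntegers p L))] in
/-- Polynomials in the entries of the universal lift: the frame variables lie in the
`𝒪`-subalgebra generated by the entries of `frameLift`. [folklore] -/
theorem frameVar_mem_adjoin {σ₀ : absoluteGaloisGroup K} (hσ₀ : IsAbsArithFrob σ₀)
    (g : GL (Fin n) (ResidueField (intermediateFieldIntegers p L))) (ij : Fin n × Fin n) :
    frameVar L n ij ∈ Algebra.adjoin (intermediateFieldIntegers p L)
      (Set.range fun t : absoluteGaloisGroup K × Fin n × Fin n =>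
        ((frameLift L hσ₀ g t.1 : GL (Fin n) (frameRing L n)) : Matrix (Fin n) (Fin n) (frameRing L n)) t.2.1 t.2.2) := by
  have h : frameVar L n ij = ((frameLift L hσ₀ g σ₀ : GL (Fin n) (frameRing L n)) : Matrix (Fin n) (Fin n) (frameRing L n))
      ij.1 ij.2 - algebraMap (intermediateFieldIntegers p L) (frameRing L n)
        (frobMatrixLift L (g : Matrix (Fin n) (Fin n) (ResidueField (intermediateFieldIntegers p L))) ij.1 ij.2) := by
    rw [frameLift_frob, coe_univUnit, univMatrix, Matrix.add_apply, RingHom.mapMatrix_apply, Matrix.map_apply,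
      Matrix.of_apply, add_sub_cancel_left]
  rw [h]
  exact Subalgebra.sub_mem _ (Algebra.subset_adjoin ⟨(σ₀, ij.1, ij.2), rfl⟩) (Subalgebra.algebraMap_mem _ _)

omit [Algebra (intermediateFieldIntegers p L) (PadicAlgCl p)] [IsScalarTower (intermediateFieldIntegers p L) L (PadicAlgCl p)]
  [TopologicalSpace (ResidueField (intermediateFieldIntegers p L))]
  [DiscreteTopology (ResidueField (intermediateFieldIntegers p L))] in
/-- **Density of the entries**: every element of `R⁰` is congruent modulo `𝔪ᵐ` to a polynomial in
the entries of the universal lift. [folklore] -/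
theorem exists_sub_mem_adjoin_frameLift {σ₀ : absoluteGaloisGroup K} (hσ₀ : IsAbsArithFrob σ₀)
    (g : GL (Fin n) (ResidueField (intermediateFieldIntegers p L))) (m : ℕ) (r : frameRing L n) :
    ∃ s ∈ Algebra.adjoin (intermediateFieldIntegers p L)
      (Set.range fun t : absoluteGaloisGroup K × Fin n × Fin n =>
        ((frameLift L hσ₀ g t.1 : GL (Fin n) (frameRing L n)) : Matrix (Fin n) (Fin n) (frameRing L n)) t.2.1 t.2.2),
      r - s ∈ maximalIdeal (frameRing L n) ^ m := by
  obtain ⟨f, hf⟩ := exists_polynomial_sub_mem_pow L n m r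
  refine ⟨_, ?_, hf⟩
  -- `algebraMap S R⁰ f = aeval frameVar f ∈ adjoin (range frameVar) ≤ adjoin (entries)`
  have heq : algebraMap (framePoly L n) (frameRing L n) f = MvPolynomial.aeval (frameVar L n) f := by
    have h2 : IsScalarTower.toAlgHom (intermediateFieldIntegers p L) (framePoly L n) (frameRing L n) =
        MvPolynomial.aeval (frameVar L n) :=
      MvPolynomial.algHom_ext fun ij => by rw [IsScalarTower.toAlgHom_apply, MvPolynomial.aeval_X]; rfl
    exact congrArg (fun φ => φ f) h2
  rw [heq]
  have hrange : MvPolynomial.aeval (frameVar L n) f ∈ (MvPolynomial.aeval (R := intermediateFieldIntegers p L)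
      (frameVar L n)).range := ⟨f, rfl⟩
  rw [← Algebra.adjoin_range_eq_range_aeval] at hrange
  refine Algebra.adjoin_le ?_ hrange
  rintro v ⟨ij, rfl⟩
  exact frameVar_mem_adjoin L hσ₀ g ij

/-- **The universal unramified framed deformation ring is a pointwise lifting ring** for the
condition "unramified (and `Q`)": `R⁰ = 𝒪_L⟦X_{ij}⟧` with the universal unramified lift.
[cite: Kisin2007, (3.3.3), (3.3.8)] -/
def unramifiedLiftingRing (hρ : ρbar.IsLocallyUnramified) (Q : Prop) (hQ : Q) :
    PointwiseLiftingRing (absoluteGaloisGroup K) p (intermediateFieldIntegers p L)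
      (ResidueField (intermediateFieldIntegers p L)) ρbar
      (fun ρ : FramedRep (absoluteGaloisGroup K) (PadicAlgCl p) n => ρ.IsLocallyUnramified ∧ Q) where
  R := frameRing L n
  isAdicComplete := inferInstance
  isReduced := inferInstance
  torsionFree r h := (mul_eq_zero.1 h).resolve_left (natCast_ne_zero_frameRing L n)
  residueMap := frameResidue L n
  lift := frameLift L (isAbsArithFrob_someFrob K) (ρbar (someFrob K))
  isOpen_setOf_lift := isOpen_setOf_frameLift L (isAbsArithFrob_someFrob K) (ρbar (someFrob K))
  residueMap_lift γ i j := frameResidue_frameLift L (isAbsArithFrob_someFrob K) (ρbar (someFrob K)) ρbar.toMonoidHom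
    (absInertia_le_ker_of_isLocallyUnramified L ρbar hρ) (isOpen_ker_residual L ρbar) rfl γ i j
  exists_sub_mem := exists_sub_mem_adjoin_frameLift L (isAbsArithFrob_someFrob K) (ρbar (someFrob K))
  point_spec x := ⟨reducesTo_frameLiftAt L (isAbsArithFrob_someFrob K) (ρbar (someFrob K)) x ρbar.toMonoidHom
      (absInertia_le_ker_of_isLocallyUnramified L ρbar hρ) (isOpen_ker_residual L ρbar) rfl,
    continuous_frameLiftAt L (isAbsArithFrob_someFrob K) (ρbar (someFrob K)) x,
    frameLiftAtC_isLocallyUnramified L (isAbsArithFrob_someFrob K) (ρbar (someFrob K)) x, hQ⟩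
  existsUnique_point ρ hred hC := by
    obtain ⟨x, hx⟩ := exists_framePoint_frameLiftAt_eq L (isAbsArithFrob_someFrob K) (ρbar (someFrob K)) ρbar.toMonoidHom
      rfl ρ.toMonoidHom ρ.continuous (fun σ hσ => (MonoidHom.mem_ker).2 (hC.1 σ hσ)) hred
    exact ⟨x, hx, fun x' hx' => framePoint_eq_of_frameLiftAt_eq L (isAbsArithFrob_someFrob K) (ρbar (someFrob K))
      (hx'.trans hx.symm)⟩

/-- The ring of `unramifiedLiftingRing` is `𝒪_L⟦X_{ij}⟧`. [folklore] -/
@[simp] theorem unramifiedLiftingRing_R (hρ : ρbar.IsLocallyUnramified) (Q : Prop) (hQ : Q) :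
    (unramifiedLiftingRing L ρbar hρ Q hQ).R = frameRing L n := rfl

end Unramified

end Literature.NumberTheory.GaloisRepresentations

end
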